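import Mathlib.Analysis.InnerProductSpace.PiL2
import Mathlib.Tactic
import HarnessLib

/-!
# Decomposable 2-forms in dimension four: the Plücker relation in self-dual / anti-self-dual
coordinates — "`φ + ψ` is a two-plane iff `|φ| = |ψ|`" (topic `Geometry/Riemannian`)

A brick of the printed proof of the named fact
`Literature.Geometry.Riemannian.hamilton_nonnegCurvatureOperator_classification_four`
(`HamiltonNCOClassification.lean`; R. S. Hamilton, *Four-manifolds with positive curvature
operator*, J. Differential Geom. 24 (1986), Thm. 1.3). In §9 (p. 178) the cases of the holonomy
algebra `𝔤 ⊂ so(4) = Λ²₊ ⊕ Λ²₋` are turned into geometry through the dictionary between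
`Λ²₊ ⊕ Λ²₋`-coordinates and 2-planes, verbatim: case 2, "the image of `M` is spanned by a single
two-form `φ`, and the Bianchi identity guarantees `φ` comes from a two-plane"; case 3, "If we take
them to have unit length, then `φ + ψ` and `φ - ψ` are two perpendicular 2-planes"; case 4, "But if
`φ ∈ Λ²₊` and `ψ ∈ Λ²₋`, then `φ + ψ` is a two-plane if and only if `|φ| = |ψ|`."

This file PROVES that dictionary entry for 2-forms on `ℝ⁴` given by their components in a frame,
`c : Fin 4 → Fin 4 → ℝ` skew (`c i j = ω(eᵢ, eⱼ)`; for a 2-vector `Σₐ Xₐ ∧ Yₐ` on a Riemannian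
4-manifold these are the frame coefficients `g.bivectorForm x X Y (e i) (e j)` of
`CurvatureOperator.lean` / `CurvatureOperatorFormFrame.lean`), with the `Λ²₊ ⊕ Λ²₋`-coordinates
`xₛ = ½(c₀,ₛ₊₁ + c_{p,q})`, `yₛ = ½(c₀,ₛ₊₁ - c_{p,q})`, `(p, q) = (2,3), (3,1), (1,2)` (the
coordinates of `curvatureOperatorForm_eq_quad_blocks`; Hamilton's bases `φₛ = e₀∧eₛ₊₁ + e_p∧e_q`,
`ψₛ = e₀∧eₛ₊₁ - e_p∧e_q`, 1997, p. 5). "Two-plane" = decomposable, `c_{ij} = aᵢ bⱼ - aⱼ bᵢ`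
(`ω = a♭ ∧ b♭`). Theorems only; no definitions, no named facts:

* `exists_eq_wedge_of_pfaffian_eq_zero` — **the Plücker relation**: a non-zero skew `c` with
  `Pf c = c₀₁c₂₃ - c₀₂c₁₃ + c₀₃c₁₂ = 0` is decomposable (explicitly: `a = c_{p·}/c_{pq}`,
  `b = c_{q·}` for any non-zero entry `c_{pq}`); `pfaffian_wedge_eq_zero` — conversely
  `Pf (a ∧ b) = 0`; `decomposable_iff_pfaffian_eq_zero`.
* `sum_sq_sub_sum_sq_eq_pfaffian` — **`|x|² - |y|² = Pf c`** for the `Λ²₊ ⊕ Λ²₋`-coordinates;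
  hence `decomposable_iff_sum_sq_eq` — **`c` is a two-plane iff `|x|² = |y|²`** (Hamilton's
  "`φ + ψ` is a two-plane if and only if `|φ| = |ψ|`").

## References

* R. S. Hamilton, *Four-manifolds with positive curvature operator*, J. Differential Geom. 24
  (1986) 153–179, §9, cases 2–4 (p. 178). [Hamilton1986]
* R. S. Hamilton, Comm. Anal. Geom. 5 (1997), §1.2, p. 5 (the bases `φᵢ`, `ψᵢ`). [Hamilton1997]
-/

noncomputable section

open Finset
open scoped BigOperators

namespace Literature.Geometry.Riemannian

namespace SkewFour

/-! ### The Plücker relation -/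

/-- **The Plücker relation**: a non-zero skew `4 × 4` array `c` with
`Pf c = c₀₁ c₂₃ - c₀₂ c₁₃ + c₀₃ c₁₂ = 0` is decomposable, `c_{ij} = aᵢ bⱼ - aⱼ bᵢ` — for any
non-zero entry `c_{pq}` one may take `a = c_{p·} / c_{pq}`, `b = c_{q·}`
(`c_{pi} c_{qj} - c_{pj} c_{qi} = c_{pq} c_{ij} ± Pf c`). [folklore] -/
theorem exists_eq_wedge_of_pfaffian_eq_zero {c : Fin 4 → Fin 4 → ℝ} (hc : ∀ i j, c i j = -c j i)
    (hPf : c 0 1 * c 2 3 - c 0 2 * c 1 3 + c 0 3 * c 1 2 = 0) (h0 : ∃ i j, c i j ≠ 0) :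
    ∃ a b : Fin 4 → ℝ, ∀ i j, c i j = a i * b j - a j * b i := by
  have d : ∀ i, c i i = 0 := fun i ↦ by have := hc i i; linarith
  have h10 := hc 1 0; have h20 := hc 2 0; have h30 := hc 3 0
  have h21 := hc 2 1; have h31 := hc 3 1; have h32 := hc 3 2
  obtain ⟨p, q, hpq⟩ := h0
  refine ⟨fun j ↦ c p j / c p q, fun j ↦ c q j, fun i j ↦ ?_⟩
  rw [div_mul_eq_mul_div, div_mul_eq_mul_div, eq_comm, sub_eq_iff_eq_add, div_eq_iff hpq,
    add_mul, div_mul_cancel₀ _ hpq]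
  fin_cases p <;> fin_cases q <;> simp only [d, ne_eq, not_true_eq_false] at hpq ⊢ <;>
    fin_cases i <;> fin_cases j <;>
    simp only [Fin.zero_eta, Fin.isValue, Fin.mk_one, Fin.reduceFinMk, d, h10, h20, h30, h21, h31,
      h32] <;>
    first
      | linear_combination hPf
      | linear_combination -hPf
      | ring1

/-- Conversely a decomposable array satisfies the Plücker relation: `Pf (a ∧ b) = 0`.
[folklore] -/
theorem pfaffian_wedge_eq_zero (a b : Fin 4 → ℝ) :
    (a 0 * b 1 - a 1 * b 0) * (a 2 * b 3 - a 3 * b 2) -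
        (a 0 * b 2 - a 2 * b 0) * (a 1 * b 3 - a 3 * b 1) +
      (a 0 * b 3 - a 3 * b 0) * (a 1 * b 2 - a 2 * b 1) = 0 := by
  ring

/-- **A skew `4 × 4` array is decomposable iff its Pfaffian vanishes.** [folklore] -/
theorem decomposable_iff_pfaffian_eq_zero {c : Fin 4 → Fin 4 → ℝ} (hc : ∀ i j, c i j = -c j i) :
    (∃ a b : Fin 4 → ℝ, ∀ i j, c i j = a i * b j - a j * b i) ↔
      c 0 1 * c 2 3 - c 0 2 * c 1 3 + c 0 3 * c 1 2 = 0 := by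
  constructor
  · rintro ⟨a, b, h⟩
    simp only [h]
    exact pfaffian_wedge_eq_zero a b
  · intro hPf
    by_cases h0 : ∃ i j, c i j ≠ 0
    · exact exists_eq_wedge_of_pfaffian_eq_zero hc hPf h0
    · push Not at h0
      exact ⟨0, 0, fun i j ↦ by simp [h0 i j]⟩

/-! ### The self-dual / anti-self-dual coordinates -/

/-- **`|x|² - |y|² = Pf c`**: for the `Λ²₊ ⊕ Λ²₋`-coordinates `xₛ = ½(c₀,ₛ₊₁ + c_{p,q})`,
`yₛ = ½(c₀,ₛ₊₁ - c_{p,q})` (`(p,q) = (2,3),(3,1),(1,2)`) of a skew array,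
`Σₛ xₛ² - Σₛ yₛ² = Σₛ c₀,ₛ₊₁ c_{p,q} = c₀₁c₂₃ - c₀₂c₁₃ + c₀₃c₁₂`. [cite: Hamilton1986, §9, case 4 (p. 178)] -/
theorem sum_sq_sub_sum_sq_eq_pfaffian {c : Fin 4 → Fin 4 → ℝ} (hc : ∀ i j, c i j = -c j i) :
    (∑ s : Fin 3, ((c 0 s.succ + c ((![2, 3, 1] : Fin 3 → Fin 4) s) ((![3, 1, 2] : Fin 3 → Fin 4) s)) / 2) ^ 2) -
        ∑ s : Fin 3, ((c 0 s.succ - c ((![2, 3, 1] : Fin 3 → Fin 4) s) ((![3, 1, 2] : Fin 3 → Fin 4) s)) / 2) ^ 2 =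
      c 0 1 * c 2 3 - c 0 2 * c 1 3 + c 0 3 * c 1 2 := by
  have h31 := hc 3 1
  have e3 : Fin.succ (2 : Fin 3) = (3 : Fin 4) := rfl
  simp only [Fin.sum_univ_three, Fin.isValue, Fin.succ_zero_eq_one, Fin.succ_one_eq_two, e3,
    Matrix.cons_val_zero, Matrix.cons_val_one, Matrix.cons_val, h31]
  ring

/-- **"`φ + ψ` is a two-plane if and only if `|φ| = |ψ|`"** (Hamilton 1986, §9, case 4, p. 178; used
also in case 2, "the Bianchi identity guarantees `φ` comes from a two-plane", and case 3, "`φ + ψ`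
and `φ - ψ` are two perpendicular 2-planes"): a skew `4 × 4` array is decomposable iff its
`Λ²₊`- and `Λ²₋`-coordinates have the same length, `Σ xₛ² = Σ yₛ²`.
[cite: Hamilton1986, §9, cases 2–4 (p. 178)] -/
theorem decomposable_iff_sum_sq_eq {c : Fin 4 → Fin 4 → ℝ} (hc : ∀ i j, c i j = -c j i) :
    (∃ a b : Fin 4 → ℝ, ∀ i j, c i j = a i * b j - a j * b i) ↔
      ∑ s : Fin 3, ((c 0 s.succ + c ((![2, 3, 1] : Fin 3 → Fin 4) s) ((![3, 1, 2] : Fin 3 → Fin 4) s)) / 2) ^ 2 =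
        ∑ s : Fin 3, ((c 0 s.succ - c ((![2, 3, 1] : Fin 3 → Fin 4) s) ((![3, 1, 2] : Fin 3 → Fin 4) s)) / 2) ^ 2 := by
  rw [decomposable_iff_pfaffian_eq_zero hc, ← sum_sq_sub_sum_sq_eq_pfaffian hc, sub_eq_zero]

end SkewFour

end Literature.Geometry.Riemannian

end
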